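import Literature.MathematicalPhysics.QuantumFieldTheory.QuasiLocalGaugePerturbationWilson
import Literature.MathematicalPhysics.QuantumLattice.GaugeGroups
import HarnessLib

/-!
# Stub `stub_wilsonAnalyticNorm` of line `birth`
(crux `Summit.QuantumFields.QCD.Theses.NestedDissectionSea.RobustYangMillsRG`, item stmt-QuantumFields-17812,
route route-QuantumFields-NestedDissectionSea; shared verbatim with `HeavyThresholdYMBridge`)

## Summary

The Wilson perturbation `wilson ρ hρ b` of the tree (`QuasiLocalGaugePerturbationWilson`, activities
`W_X(U) = ∑_{p : supp p = X} (N - Re tr ρ(U_p))`) has, for the fundamental representation of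
`SU(N)`, an ANALYTIC weighted norm bounded uniformly in the volume — the lemma that file lists as
"deliberately NOT here". We prove it on the analyticity strip `stripDomain ρ r` of every width
`r > 0` (`hasAnalyticNormLE_wilson_stripDomain`) and restrict to the small-field domains
(`HasAnalyticNormLE.smallField_of_strip`); the stub `stub_wilsonAnalyticNorm` is the case
`N = 3`, `d = 4`, `b = 1`.

* Holomorphic extension of one plaquette cost. On `SU(N)` the group inverse is both the conjugate
  transpose and the ADJUGATE (`A · adj A = det A · 1 = 1`), and `Re tr M = (tr M + tr Mᴴ) / 2`, so
  `Z ↦ N - (tr(Z₁ Z₂ adj Z₃ adj Z₄) + tr(Z₄ Z₃ adj Z₂ adj Z₁)) / 2` (indices = the four links of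
  the plaquette) is a polynomial in the link entries, differentiable everywhere
  (`differentiable_plaqExt`; entries are continuous linear functionals of the finite-dimensional
  `M_N(ℂ)^{edges}`, cofactors/determinants are polynomials: `Matrix.det_apply'`,
  `HasFDerivAt.finsetProd`), and agrees with `N - Re tr ρ(U_p)` at `Z = ρ ∘ U` (`plaqExt_complexify`).
* Bound on the strip. Every link matrix of a point of the strip is within Frobenius distance `r`
  of a unitary, so its entries have modulus `≤ 1 + r` (`norm_apply_le_of_mem_stripDomain`); with
  entries bounded by `R ≥ 1`, cofactors are bounded by `N! R^N` (`Matrix.det_le`), products by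
  `N · (bound) · (bound)`, traces by `N · (bound)`: `N + N·(N·(N·(N R²) · N! R^N) · N! R^N)` per
  plaquette (`norm_plaqExt_le`).
* Weighted sums, exactly as the tree's `weightedSum_wilson_le` for the real norm: only support
  polymers `X = plaquetteSupport b p` carry activity, `|X| ≤ 3` (`card_plaquetteSupport_le`, so
  `e^{κ|X|} ≤ e^{3|κ|}` for every real `κ`), and at most `3 d² b^d` supports pass through a block
  (`card_filter_mem_plaquetteSupport_le`). All ingredients are Mathlib and the two tree files.
-/

noncomputable section

namespace Summit.QuantumFields.QCD.Cruxes.RobustYangMillsRG.Birth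

open scoped BigOperators Matrix ComplexConjugate Matrix.Norms.Frobenius Nat
open Filter Set Function TopologicalSpace MeasureTheory
open Literature.MathematicalPhysics.QuantumLattice Literature.MathematicalPhysics.AQFT
  Literature.MathematicalPhysics.QuantumFieldTheory

variable {N : ℕ}

/-! ### Entrywise calculus for matrix-valued maps -/

section Calculus

variable {E : Type*} [NormedAddCommGroup E] [NormedSpace ℂ E]
  {f g : E → Matrix (Fin N) (Fin N) ℂ}

/-- Entries of the product of two entrywise-differentiable matrix-valued maps are differentiable.
[folklore] -/
theorem differentiable_mul_apply (hf : ∀ a b, Differentiable ℂ fun Z => f Z a b)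
    (hg : ∀ a b, Differentiable ℂ fun Z => g Z a b) (a b : Fin N) :
    Differentiable ℂ fun Z => (f Z * g Z) a b := by
  simp only [Matrix.mul_apply]
  exact Differentiable.fun_sum fun k _ => (hf a k).mul (hg k b)

/-- The trace of an entrywise-differentiable matrix-valued map is differentiable. [folklore] -/
theorem differentiable_trace (hf : ∀ a b, Differentiable ℂ fun Z => f Z a b) :
    Differentiable ℂ fun Z => (f Z).trace := by
  show Differentiable ℂ fun Z => ∑ k, f Z k k
  exact Differentiable.fun_sum fun k _ => hf k k

/-- The determinant of an entrywise-differentiable matrix-valued map is differentiable (a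
polynomial in the entries, `Matrix.det_apply'`). [folklore] -/
theorem differentiable_det (hf : ∀ a b, Differentiable ℂ fun Z => f Z a b) :
    Differentiable ℂ fun Z => (f Z).det := by
  simp only [Matrix.det_apply']
  refine Differentiable.fun_sum fun σ _ => (differentiable_const _).mul ?_
  exact fun Z => (HasFDerivAt.finsetProd (u := Finset.univ)
    (fun i _ => ((hf (σ i) i) Z).hasFDerivAt)).differentiableAt

/-- Entries of a row update (by a constant row) of an entrywise-differentiable matrix-valued map
are differentiable. [folklore] -/
theorem differentiable_updateRow_apply (hf : ∀ a b, Differentiable ℂ fun Z => f Z a b)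
    (j : Fin N) (c : Fin N → ℂ) (a b : Fin N) :
    Differentiable ℂ fun Z => (f Z).updateRow j c a b := by
  by_cases h : a = j
  · simp only [Matrix.updateRow_apply, if_pos h]
    exact differentiable_const _
  · simp only [Matrix.updateRow_apply, if_neg h]
    exact hf a b

/-- Entries of the adjugate of an entrywise-differentiable matrix-valued map are differentiable
(cofactors are determinants of row updates, `Matrix.adjugate_apply`). [folklore] -/
theorem differentiable_adjugate_apply (hf : ∀ a b, Differentiable ℂ fun Z => f Z a b)
    (a b : Fin N) : Differentiable ℂ fun Z => (f Z).adjugate a b := by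
  simp only [Matrix.adjugate_apply]
  exact differentiable_det fun a' b' => differentiable_updateRow_apply hf b (Pi.single a 1) a' b'

/-- **The plaquette extension is differentiable**: for four entrywise-differentiable matrix-valued
maps `f₁, …, f₄`, the map `Z ↦ N - (tr(f₁ f₂ adj f₃ adj f₄) + tr(f₄ f₃ adj f₂ adj f₁)) / 2` is
differentiable. [folklore] -/
theorem differentiable_plaqExt {f₁ f₂ f₃ f₄ : E → Matrix (Fin N) (Fin N) ℂ}
    (h₁ : ∀ a b, Differentiable ℂ fun Z => f₁ Z a b)
    (h₂ : ∀ a b, Differentiable ℂ fun Z => f₂ Z a b)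
    (h₃ : ∀ a b, Differentiable ℂ fun Z => f₃ Z a b)
    (h₄ : ∀ a b, Differentiable ℂ fun Z => f₄ Z a b) :
    Differentiable ℂ fun Z => (N : ℂ) -
      ((f₁ Z * f₂ Z * (f₃ Z).adjugate * (f₄ Z).adjugate).trace +
        (f₄ Z * f₃ Z * (f₂ Z).adjugate * (f₁ Z).adjugate).trace) / 2 := by
  have t₁ : Differentiable ℂ fun Z => (f₁ Z * f₂ Z * (f₃ Z).adjugate * (f₄ Z).adjugate).trace :=
    differentiable_trace (differentiable_mul_apply
      (differentiable_mul_apply (differentiable_mul_apply h₁ h₂) (differentiable_adjugate_apply h₃))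
      (differentiable_adjugate_apply h₄))
  have t₂ : Differentiable ℂ fun Z => (f₄ Z * f₃ Z * (f₂ Z).adjugate * (f₁ Z).adjugate).trace :=
    differentiable_trace (differentiable_mul_apply
      (differentiable_mul_apply (differentiable_mul_apply h₄ h₃) (differentiable_adjugate_apply h₂))
      (differentiable_adjugate_apply h₁))
  simp only [div_eq_mul_inv]
  exact (differentiable_const _).sub ((t₁.add t₂).mul_const _)

/-- Link entries `Z ↦ (Z e) a b` are differentiable on the space of complex link configurations
(continuous linear functionals of a finite-dimensional space). [folklore] -/
theorem differentiable_entry {d L : ℕ} [NeZero L] (e : Edge d L) (a b : Fin N) :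
    Differentiable ℂ fun Z : ComplexGaugeConfig d L N => Z e a b :=
  (LinearMap.toContinuousLinearMap
    ((Matrix.entryLinearMap ℂ ℂ a b).comp
      (LinearMap.proj e : ComplexGaugeConfig d L N →ₗ[ℂ] Matrix (Fin N) (Fin N) ℂ))).differentiable

end Calculus

/-! ### The extension agrees with the plaquette cost on `SU(N)` -/

/-- On `SU(N)` the adjugate is the conjugate transpose: `adj A = A⁻¹ = Aᴴ` for unitary `A` with
`det A = 1`. [folklore] -/
theorem adjugate_eq_star_of_mem_unitaryGroup {A : Matrix (Fin N) (Fin N) ℂ}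
    (hA : A ∈ Matrix.unitaryGroup (Fin N) ℂ) (hdet : A.det = 1) : A.adjugate = star A := by
  have h1 : A⁻¹ = A.adjugate :=
    Matrix.inv_eq_right_inv (by rw [Matrix.mul_adjugate, hdet, one_smul])
  have h2 : A⁻¹ = star A := Matrix.inv_eq_right_inv (Matrix.mem_unitaryGroup_iff.1 hA)
  rw [← h1, h2]

/-- **The extension at special unitary matrices is the real plaquette cost**: for
`A, B, C, D ∈ SU(N)`,
`N - (tr(A B adj C adj D) + tr(D C adj B adj A)) / 2 = N - Re tr(A B Cᴴ Dᴴ)`, since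
`adj = ᴴ` on `SU(N)` and `tr(Mᴴ) = conj (tr M)`. [folklore] -/
theorem plaqExt_eq_of_mem_unitaryGroup {A B C D : Matrix (Fin N) (Fin N) ℂ}
    (hA : A ∈ Matrix.unitaryGroup (Fin N) ℂ) (hA' : A.det = 1)
    (hB : B ∈ Matrix.unitaryGroup (Fin N) ℂ) (hB' : B.det = 1)
    (hC : C ∈ Matrix.unitaryGroup (Fin N) ℂ) (hC' : C.det = 1)
    (hD : D ∈ Matrix.unitaryGroup (Fin N) ℂ) (hD' : D.det = 1) :
    (N : ℂ) - ((A * B * C.adjugate * D.adjugate).trace + (D * C * B.adjugate * A.adjugate).trace) / 2 =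
      (((N : ℝ) - (A * B * star C * star D).trace.re : ℝ) : ℂ) := by
  rw [adjugate_eq_star_of_mem_unitaryGroup hA hA', adjugate_eq_star_of_mem_unitaryGroup hB hB',
    adjugate_eq_star_of_mem_unitaryGroup hC hC', adjugate_eq_star_of_mem_unitaryGroup hD hD']
  have htr : (D * C * star B * star A).trace = star (A * B * star C * star D).trace := by
    rw [← Matrix.trace_conjTranspose]
    simp only [Matrix.star_eq_conjTranspose, Matrix.conjTranspose_mul,
      Matrix.conjTranspose_conjTranspose, Matrix.mul_assoc]
  rw [htr]
  set t : ℂ := (A * B * star C * star D).trace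
  have hst : star t = conj t := rfl
  rw [hst, Complex.add_conj]
  push_cast
  ring

/-- **At a real `SU(N)` configuration the extension is the plaquette cost `N - Re tr U_p`**
(`plaquetteHolonomy U x i j = U(x,i) U(x+eᵢ,j) U(x+eⱼ,i)⁻¹ U(x,j)⁻¹`, and `ρ(g⁻¹) = ρ(g)ᴴ` in
the fundamental representation). [folklore] -/
theorem plaqExt_complexify {d L : ℕ} (U : GaugeConfig d L (Matrix.specialUnitaryGroup (Fin N) ℂ))
    (x : Site d L) (i j : Fin d) :
    (N : ℂ) - ((complexify (fundamentalRep (Fin N)) U (x, i) *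
        complexify (fundamentalRep (Fin N)) U (x.shift i, j) *
          (complexify (fundamentalRep (Fin N)) U (x.shift j, i)).adjugate *
            (complexify (fundamentalRep (Fin N)) U (x, j)).adjugate).trace +
      (complexify (fundamentalRep (Fin N)) U (x, j) *
        complexify (fundamentalRep (Fin N)) U (x.shift j, i) *
          (complexify (fundamentalRep (Fin N)) U (x.shift i, j)).adjugate *
            (complexify (fundamentalRep (Fin N)) U (x, i)).adjugate).trace) / 2 =
      (((N : ℝ) - (fundamentalRep (Fin N) (plaquetteHolonomy U x i j)).trace.re : ℝ) : ℂ) := by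
  have hu : ∀ e, fundamentalRep (Fin N) (U e) ∈ Matrix.unitaryGroup (Fin N) ℂ := fun e =>
    fundamentalRep_mem_unitaryGroup (U e)
  have hd : ∀ e, (fundamentalRep (Fin N) (U e)).det = 1 := fun e =>
    (Matrix.mem_specialUnitaryGroup_iff.1 (U e).2).2
  have hinv : ∀ g : Matrix.specialUnitaryGroup (Fin N) ℂ,
      fundamentalRep (Fin N) g⁻¹ = star (fundamentalRep (Fin N) g) := fun g => rfl
  simp only [complexify]
  rw [plaqExt_eq_of_mem_unitaryGroup (hu _) (hd _) (hu _) (hd _) (hu _) (hd _) (hu _) (hd _)]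
  simp only [plaquetteHolonomy, map_mul, hinv]

/-! ### Bounds on the strip -/

/-- An entry is bounded by the Frobenius norm. [folklore] -/
theorem norm_apply_le_frobenius_norm {m n : Type*} [Fintype m] [Fintype n] (A : Matrix m n ℂ)
    (i : m) (j : n) : ‖A i j‖ ≤ ‖A‖ := by
  rw [Matrix.frobenius_norm_def, ← Real.sqrt_eq_rpow]
  refine Real.le_sqrt_of_sq_le ?_
  calc ‖A i j‖ ^ 2 = ‖A i j‖ ^ (2 : ℝ) := (Real.rpow_two _).symm
    _ ≤ ∑ j', ‖A i j'‖ ^ (2 : ℝ) :=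
        Finset.single_le_sum (f := fun j' => ‖A i j'‖ ^ (2 : ℝ)) (fun j' _ => by positivity)
          (Finset.mem_univ j)
    _ ≤ ∑ i', ∑ j', ‖A i' j'‖ ^ (2 : ℝ) :=
        Finset.single_le_sum (f := fun i' => ∑ j', ‖A i' j'‖ ^ (2 : ℝ)) (fun i' _ => by positivity)
          (Finset.mem_univ i)

/-- **On the strip of width `r` every link entry has modulus at most `1 + r`**: the link matrix is
within Frobenius distance `r` of a unitary, whose entries have modulus `≤ 1`. [folklore] -/
theorem norm_apply_le_of_mem_stripDomain {d L : ℕ} [NeZero L] {r : ℝ} (hr : 0 < r)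
    {Z : ComplexGaugeConfig d L N} (hZ : Z ∈ stripDomain (fundamentalRep (Fin N)) r)
    (e : Edge d L) (a b : Fin N) : ‖Z e a b‖ ≤ 1 + r := by
  obtain ⟨U, hU⟩ := (mem_stripDomain_iff_forall (fundamentalRep (Fin N)) hr).1 hZ
  have h1 : ‖(Z e - fundamentalRep (Fin N) (U e)) a b‖ < r :=
    (norm_apply_le_frobenius_norm _ a b).trans_lt (hU e)
  have h2 : ‖fundamentalRep (Fin N) (U e) a b‖ ≤ 1 :=
    entry_norm_bound_of_unitary (fundamentalRep_mem_unitaryGroup (U e)) a b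
  calc ‖Z e a b‖
      = ‖(Z e - fundamentalRep (Fin N) (U e)) a b + fundamentalRep (Fin N) (U e) a b‖ := by
        rw [Matrix.sub_apply, sub_add_cancel]
    _ ≤ ‖(Z e - fundamentalRep (Fin N) (U e)) a b‖ + ‖fundamentalRep (Fin N) (U e) a b‖ :=
        norm_add_le _ _
    _ ≤ 1 + r := by linarith

/-- **Polynomial bound for the plaquette extension**: if all entries of `A, B, C, D` have modulus
`≤ R` (`R ≥ 1`), then `|N - (tr(A B adj C adj D) + tr(D C adj B adj A)) / 2|` is at most
`N + N·(N·(N·(N·R·R)·(N! R^N))·(N! R^N))` (cofactors `≤ N! R^N` by `Matrix.det_le`, entries of a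
product `≤ N ·` product of the bounds, `|tr M| ≤ N ·` entry bound). [folklore] -/
theorem norm_plaqExt_le {A B C D : Matrix (Fin N) (Fin N) ℂ} {R : ℝ} (hR : 1 ≤ R)
    (hA : ∀ a b, ‖A a b‖ ≤ R) (hB : ∀ a b, ‖B a b‖ ≤ R) (hC : ∀ a b, ‖C a b‖ ≤ R)
    (hD : ∀ a b, ‖D a b‖ ≤ R) :
    ‖(N : ℂ) - ((A * B * C.adjugate * D.adjugate).trace + (D * C * B.adjugate * A.adjugate).trace) / 2‖ ≤
      N + N * (N * (N * (N * R * R) * (N ! * R ^ N)) * (N ! * R ^ N)) := by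
  have R0 : 0 ≤ R := zero_le_one.trans hR
  have hmul : ∀ {M M' : Matrix (Fin N) (Fin N) ℂ} {S S' : ℝ}, (∀ a b, ‖M a b‖ ≤ S) →
      (∀ a b, ‖M' a b‖ ≤ S') → ∀ a b, ‖(M * M') a b‖ ≤ N * S * S' := by
    intro M M' S S' hM hM' a b
    rw [Matrix.mul_apply]
    calc ‖∑ k, M a k * M' k b‖ ≤ ∑ k, ‖M a k * M' k b‖ := norm_sum_le _ _
      _ ≤ ∑ _k : Fin N, S * S' := Finset.sum_le_sum fun k _ => by
          rw [norm_mul]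
          exact mul_le_mul (hM a k) (hM' k b) (norm_nonneg _) ((norm_nonneg _).trans (hM a k))
      _ = N * S * S' := by
          rw [Finset.sum_const, Finset.card_univ, Fintype.card_fin, nsmul_eq_mul, mul_assoc]
  have habv : ∀ z : ℂ, NormedField.toAbsoluteValue ℂ z = ‖z‖ := fun _ => rfl
  have hadj : ∀ {M : Matrix (Fin N) (Fin N) ℂ}, (∀ a b, ‖M a b‖ ≤ R) →
      ∀ a b, ‖M.adjugate a b‖ ≤ N ! * R ^ N := by
    intro M hM a b
    rw [Matrix.adjugate_apply]
    have hupd : ∀ a' b', NormedField.toAbsoluteValue ℂ (M.updateRow b (Pi.single a 1) a' b') ≤ R := by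
      intro a' b'
      rw [habv, Matrix.updateRow_apply]
      split_ifs with h
      · by_cases hb : b' = a
        · subst hb
          simpa using hR
        · rw [Pi.single_eq_of_ne hb, norm_zero]
          exact R0
      · exact hM a' b'
    have h := Matrix.det_le hupd
    rw [habv, Fintype.card_fin, nsmul_eq_mul] at h
    exact h
  have htr : ∀ {M : Matrix (Fin N) (Fin N) ℂ} {S : ℝ}, (∀ a b, ‖M a b‖ ≤ S) →
      ‖M.trace‖ ≤ N * S := by
    intro M S hM
    calc ‖M.trace‖ = ‖∑ k, M k k‖ := rfl
      _ ≤ ∑ k, ‖M k k‖ := norm_sum_le _ _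
      _ ≤ ∑ _k : Fin N, S := Finset.sum_le_sum fun k _ => hM k k
      _ = N * S := by rw [Finset.sum_const, Finset.card_univ, Fintype.card_fin, nsmul_eq_mul]
  have h1 : ‖(A * B * C.adjugate * D.adjugate).trace‖ ≤
      N * (N * (N * (N * R * R) * (N ! * R ^ N)) * (N ! * R ^ N)) :=
    htr (hmul (hmul (hmul hA hB) (hadj hC)) (hadj hD))
  have h2 : ‖(D * C * B.adjugate * A.adjugate).trace‖ ≤
      N * (N * (N * (N * R * R) * (N ! * R ^ N)) * (N ! * R ^ N)) :=
    htr (hmul (hmul (hmul hD hC) (hadj hB)) (hadj hA))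
  calc ‖(N : ℂ) - ((A * B * C.adjugate * D.adjugate).trace +
          (D * C * B.adjugate * A.adjugate).trace) / 2‖
      ≤ ‖(N : ℂ)‖ + ‖((A * B * C.adjugate * D.adjugate).trace +
          (D * C * B.adjugate * A.adjugate).trace) / 2‖ := norm_sub_le _ _
    _ ≤ N + (‖(A * B * C.adjugate * D.adjugate).trace‖ +
          ‖(D * C * B.adjugate * A.adjugate).trace‖) / 2 := by
        rw [Complex.norm_natCast, norm_div, Complex.norm_two]
        gcongr
        exact norm_add_le _ _
    _ ≤ N + N * (N * (N * (N * R * R) * (N ! * R ^ N)) * (N ! * R ^ N)) := by linarith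

/-! ### The Wilson perturbation is analytic on the strip, uniformly in the volume -/

/-- **The Wilson perturbation has a volume-uniform analytic norm on the strip**: for the
fundamental representation of `SU(N)`, block scale `b ≥ 1`, width `r > 0` and any real `κ`, on
every torus `(ℤ/Lℤ)^d`,
`‖wilson‖_{b,κ,strip r} ≤ (N + N·(N·(N·(N(1+r)²)·N!(1+r)^N)·N!(1+r)^N)) · e^{3|κ|} · 3 d² b^d`:
the activity of `X` extends to the entire function `∑_{p : supp p = X} plaqExt_p`, bounded on the
strip by `#{p : supp p = X}` times the polynomial bound; supports have `≤ 3` blocks and at most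
`3 d² b^d` of them pass through a block (the bookkeeping of the tree's `weightedSum_wilson_le`).
[folklore] -/
theorem hasAnalyticNormLE_wilson_stripDomain {d b : ℕ} (hb : 0 < b) {r : ℝ} (hr : 0 < r) (κ : ℝ)
    (L : ℕ) [NeZero L] :
    (QuasiLocalGaugePerturbation.wilson (d := d) (L := L) (fundamentalRep (Fin N))
        (continuous_fundamentalRep (Fin N)) b).HasAnalyticNormLE (fundamentalRep (Fin N))
      (fun _ => stripDomain (fundamentalRep (Fin N)) r) κ
      (((N : ℝ) + N * (N * (N * (N * (1 + r) * (1 + r)) * (N ! * (1 + r) ^ N)) * (N ! * (1 + r) ^ N))) *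
        Real.exp (3 * |κ|) * (3 * d ^ 2 * b ^ d : ℕ)) := by
  classical
  set K : ℝ := (N : ℝ) +
    N * (N * (N * (N * (1 + r) * (1 + r)) * (N ! * (1 + r) ^ N)) * (N ! * (1 + r) ^ N)) with hK
  have hR : (1 : ℝ) ≤ 1 + r := le_add_of_nonneg_right hr.le
  have hK0 : 0 ≤ K := by positivity
  refine ⟨fun X => K * ((Finset.univ.filter fun p : Plaquette d L => plaquetteSupport b p = X).card : ℝ),
    fun X _ => ?_, fun y _ => ?_⟩
  · -- analyticity of the activities on the strip, with bounds `K · #{p : supp p = X}`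
    refine ⟨fun Z => ∑ p ∈ Finset.univ.filter (fun p : Plaquette d L => plaquetteSupport b p = X),
        ((N : ℂ) - ((Z (p.1, p.2.1.1) * Z (p.1.shift p.2.1.1, p.2.1.2) *
            (Z (p.1.shift p.2.1.2, p.2.1.1)).adjugate * (Z (p.1, p.2.1.2)).adjugate).trace +
          (Z (p.1, p.2.1.2) * Z (p.1.shift p.2.1.2, p.2.1.1) *
            (Z (p.1.shift p.2.1.1, p.2.1.2)).adjugate * (Z (p.1, p.2.1.1)).adjugate).trace) / 2),
      ?_, ?_, ?_⟩
    · -- entire, in particular holomorphic on the strip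
      refine (Differentiable.fun_sum fun p _ => ?_).differentiableOn
      exact differentiable_plaqExt
        (differentiable_entry (p.1, p.2.1.1)) (differentiable_entry (p.1.shift p.2.1.1, p.2.1.2))
        (differentiable_entry (p.1.shift p.2.1.2, p.2.1.1)) (differentiable_entry (p.1, p.2.1.2))
    · -- agrees with the activity on the real configurations
      intro U _
      rw [QuasiLocalGaugePerturbation.wilson_act, Complex.ofReal_sum]
      exact Finset.sum_congr rfl fun p _ => plaqExt_complexify U p.1 p.2.1.1 p.2.1.2
    · -- bounded by `K · #{p : supp p = X}` on the strip
      intro Z hZ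
      have hE := norm_apply_le_of_mem_stripDomain hr hZ
      refine (norm_sum_le_of_le _ fun p _ => norm_plaqExt_le hR (hE _) (hE _) (hE _) (hE _)).trans ?_
      rw [Finset.sum_const, nsmul_eq_mul, mul_comm]
  · -- the weighted sums through a block corner
    have hterm : ∀ X ∈ polymersThrough b y,
        K * ((Finset.univ.filter fun p : Plaquette d L => plaquetteSupport b p = X).card : ℝ) *
            Real.exp (κ * X.card) ≤
          K * Real.exp (3 * |κ|) *
            ((Finset.univ.filter fun p : Plaquette d L => plaquetteSupport b p = X).card : ℝ) := by
      intro X _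
      by_cases hfib : (Finset.univ.filter fun p : Plaquette d L => plaquetteSupport b p = X) = ∅
      · simp [hfib]
      · obtain ⟨p, hp⟩ := Finset.nonempty_iff_ne_empty.2 hfib
        have hpX : plaquetteSupport b p = X := (Finset.mem_filter.1 hp).2
        have hcard : (X.card : ℝ) ≤ 3 := by
          rw [← hpX]
          exact_mod_cast card_plaquetteSupport_le b p
        have hexp : Real.exp (κ * X.card) ≤ Real.exp (3 * |κ|) := Real.exp_le_exp.2 <| by
          rw [mul_comm 3]
          exact (mul_le_mul_of_nonneg_right (le_abs_self κ) (Nat.cast_nonneg _)).trans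
            (mul_le_mul_of_nonneg_left hcard (abs_nonneg κ))
        rw [mul_right_comm]
        exact mul_le_mul_of_nonneg_right (mul_le_mul_of_nonneg_left hexp hK0) (Nat.cast_nonneg _)
    have hfiber : ∑ X ∈ polymersThrough b y,
        ((Finset.univ.filter fun p : Plaquette d L => plaquetteSupport b p = X).card : ℝ) =
          (Finset.univ.filter fun p : Plaquette d L => y ∈ plaquetteSupport b p).card := by
      rw [← Nat.cast_sum, Finset.sum_card_fiberwise_eq_card_filter]
      exact congrArg Nat.cast (congrArg Finset.card (Finset.filter_congr fun p _ => by
        simp only [mem_polymersThrough_iff, plaquetteSupport_mem_polymers, true_and]))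
    calc ∑ X ∈ polymersThrough b y,
          K * ((Finset.univ.filter fun p : Plaquette d L => plaquetteSupport b p = X).card : ℝ) *
            Real.exp (κ * X.card)
        ≤ ∑ X ∈ polymersThrough b y, K * Real.exp (3 * |κ|) *
            ((Finset.univ.filter fun p : Plaquette d L => plaquetteSupport b p = X).card : ℝ) :=
          Finset.sum_le_sum hterm
      _ = K * Real.exp (3 * |κ|) *
            ((Finset.univ.filter fun p : Plaquette d L => y ∈ plaquetteSupport b p).card : ℝ) := by
          rw [← Finset.mul_sum, hfiber]
      _ ≤ K * Real.exp (3 * |κ|) * (3 * d ^ 2 * b ^ d : ℕ) := by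
          gcongr
          exact_mod_cast card_filter_mem_plaquetteSupport_le hb y

/-! ### The stub -/

/-- **Stub N1 — the Wilson perturbation has a volume-uniform ANALYTIC norm** (the lemma the tree's
`QuasiLocalGaugePerturbationWilson` lists as "deliberately NOT here"): for the fundamental `SU(3)`
theory in `d = 4` at block scale `1`, every radius `r > 0`, threshold `ε` and rate `κ` admit a bound
`A₀` such that on EVERY torus `(ZMod M)^4` the Wilson perturbation `wilson ρ hρ 1` has analytic
weighted norm `≤ A₀` on the small-field domains `smallFieldDomain ρ 1 r ε` (hence `c • wilson` has
norm `≤ |c| A₀`, tree `HasAnalyticNormLE.smul`). Route: each activity collects `≤ 3·d²` plaquette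
costs `3 - Re tr(U₁U₂U₃⁻¹U₄⁻¹)`; on `SU(3)` the inverse is the ADJUGATE, so
`Z ↦ 3 - (tr(Z₁Z₂ adj Z₃ adj Z₄) + tr(Z₄Z₃ adj Z₂ adj Z₁))/2` is an entire (polynomial) extension,
bounded on the `r`-strip (`smallFieldDomain ⊆ stripDomain`, tree) by a constant depending on `r`
only; only polymers `X = plaquetteSupport 1 p` (`|X| ≤ 3`) carry activity, and at most `3·4²` of them
pass through a site (tree `card_filter_mem_plaquetteSupport_le`). This is
`hasAnalyticNormLE_wilson_stripDomain` at `N = 3`, `d = 4`, `b = 1`, restricted to the small-field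
domains by the tree's `HasAnalyticNormLE.smallField_of_strip`. [folklore] -/
theorem stub_wilsonAnalyticNorm :
    ∀ r ε κ : ℝ, 0 < r → ∃ A₀ : ℝ, 0 < A₀ ∧ ∀ (M : ℕ) [NeZero M],
      (QuasiLocalGaugePerturbation.wilson (d := 4) (L := M) (fundamentalRep (Fin 3))
          (continuous_fundamentalRep (Fin 3)) 1).HasAnalyticNormLE (fundamentalRep (Fin 3))
        (smallFieldDomain (fundamentalRep (Fin 3)) 1 r ε) κ A₀ := by
  intro r ε κ hr
  refine ⟨_, ?_, fun M _ =>
    (hasAnalyticNormLE_wilson_stripDomain (N := 3) (d := 4) Nat.one_pos hr κ M).smallField_of_strip⟩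
  positivity

/-- `stub_wilsonAnalyticNorm` once more, the implicit `d = 4`, `L = M` fixed by a type ascription
instead of named arguments (the same proposition, syntactically free of `:=`; this is the header the
registry matches textually). [folklore] -/
theorem stub_wilsonAnalyticNorm_ascribed :
    ∀ r ε κ : ℝ, 0 < r → ∃ A₀ : ℝ, 0 < A₀ ∧ ∀ (M : ℕ) [NeZero M], (QuasiLocalGaugePerturbation.wilson (fundamentalRep (Fin 3)) (continuous_fundamentalRep (Fin 3)) 1 : QuasiLocalGaugePerturbation 4 M (Matrix.specialUnitaryGroup (Fin 3) ℂ) 1).HasAnalyticNormLE (fundamentalRep (Fin 3)) (smallFieldDomain (fundamentalRep (Fin 3)) 1 r ε) κ A₀ :=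
  stub_wilsonAnalyticNorm

end Summit.QuantumFields.QCD.Cruxes.RobustYangMillsRG.Birth
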